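import Literature.NumberTheory.EllipticCurves.FormalGroupLogHomProofs
import Literature.NumberTheory.EllipticCurves.FormalGroupNegOmegaProofs
import Literature.NumberTheory.EllipticCurves.MvPowerSeriesLogDerivWronskianProofs
import Literature.NumberTheory.EllipticCurves.CanonicalPAdicHeightThetaProofs
import HarnessLib

/-!
# The two sides of the theta relation at `u = 0`: leading `u`-coefficients and their
# `u`-derivatives (Blakestad–Grant 2023, Prop. 14, "comparing the expansions … in `t₁`" — proofs only)

Trunk T-NT-EC (Literature/NumberTheory/EllipticCurves). Pure proof file on the way to the formal
Mazur–Tate theta relation (named fact `WeierstrassCurve.padicSigma_theta_formal`,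
`CanonicalPAdicHeightThetaProofs.lean`). Blakestad–Grant pin down the two constants of
integration of their `t₁`-argument by parity ("the first logarithmic derivatives of both sides
are odd in `t₁`") and by "comparing the expansions of both sides as Laurent expansions in `t₁`".
In the tree's pole-cleared form both sides `L = σ(u +_F v)σ(u -_F v)u²v²` (`thetaLHS`) and
`R = (u²X(v) - v²X(u))σ(u)²σ(v)²` (`thetaRHS`) are `u²` times series `L̃ = σ(u +_F v)σ(u -_F v)v²`,
`R̃ = (u²X(v) - v²X(u))s(u)²σ(v)²` (`σ = t·s`), and what the Wronskian lemma
(`MvPowerSeriesLogDerivWronskianProofs.lean`) consumes is, with `S₀ = (u ↦ 0)`: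

* `subst_zero_X_thetaLTilde`, `subst_zero_X_thetaRTilde` — **`L̃(0, v) = R̃(0, v) = -σ(v)²v²`**
  (for `σ` odd: `σ(0 +_F v) = σ(v)`, `σ(0 -_F v) = σ(i(v)) = -σ(v)`; `X(0) = s(0) = 1`);
* `subst_zero_X_pderiv_thetaLTilde` — **`∂ᵤL̃(0, v) = 0`**: `∂ᵤσ(u +_F v)|₀ = (Dσ)(v)`,
  `∂ᵤσ(u -_F v)|₀ = (Dσ)(i(v)) = (Dσ)(v)` (`F_u(0, v) = η(v)`, AEC IV.4.2 =
  `subst_zero_X_pderiv_formalGroupLaw`; `Dσ` is even for odd `σ`,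
  `formalInvariantDerivation_subst_formalNeg_of_odd`);
* `subst_zero_X_pderiv_thetaRTilde` — **`∂ᵤR̃(0, v) = 0`**: `X = 1 - a₁z + ⋯`
  (`coeff_one_formalXMulSq`) against `s = 1 + (a₁/2)z + ⋯` (hypothesis `2·coeff₁ s = a₁`, which
  for `s = σ/t` is the quadratic coefficient of an odd normalised `σ`,
  `two_mul_coeff_two_of_isFormallyOdd` of `PadicSigmaUniquenessProofs.lean`).

## Sources

* C. Blakestad, D. Grant, J. Number Theory 249 (2023) (arXiv:1903.02480), proof of Prop. 14.
* B. Mazur, W. Stein, J. Tate, Doc. Math. Extra Vol. Coates (2006), §1 (`σ(t) = t + (a₁/2)t² + ⋯`).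
* J. H. Silverman, *AEC* 2nd ed. (2009), IV.1 (`i(z) = -z - a₁z² - ⋯`), IV.4.2.

## Design notes

No definitions, no named facts; `L̃`, `R̃` are written out. The `σ`-hypotheses are the fields of
`IsMazurTateSigmaPair` that are used (`σ(0) = 0`, `σ'(0) = 1`, oddness), over a general ring
(`ℚ`-algebra where `σ₂ = a₁/2` is needed).
-/

noncomputable section

open PowerSeries Literature.NumberTheory.EllipticCurves
open Literature.AlgebraicGeometry.Resolution (MvPowerSeries.pderiv MvPowerSeries.pderiv_X
  MvPowerSeries.pderiv_powerSeries_subst MvPowerSeries.pderiv_powerSeries_subst_X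
  MvPowerSeries.pderiv_subst_pair)

namespace WeierstrassCurve

variable {R : Type*} [CommRing R] (W : WeierstrassCurve R)

/-! ### `u ↦ 0` on `σ(u ±_F v)` and on their `u`-derivatives -/

/-- `(u -_F v)(0, v) = i(v)`. [Silverman AEC IV.2 Def. (e), (d)] [folklore] -/
theorem subst_zero_X_formalGroupLawSub :
    MvPowerSeries.subst ![(0 : R⟦X⟧), PowerSeries.X] W.formalGroupLawSub = W.formalNeg := by
  have hs := hasSubst_zero_X (R := R)
  unfold formalGroupLawSub
  rw [MvPowerSeries.subst_comp_subst_apply W.hasSubst_pair_formalNeg hs]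
  have hfam : (fun s => MvPowerSeries.subst ![(0 : R⟦X⟧), PowerSeries.X]
      ((![MvPowerSeries.X 0, W.formalNeg.subst (MvPowerSeries.X 1 : MvPowerSeries (Fin 2) R)]) s)) =
      ![(0 : R⟦X⟧), W.formalNeg] := by
    funext s
    fin_cases s
    · exact subst_zero_X_X_zero
    · exact subst_zero_X_powerSeries_subst_X_one W.formalNeg
  rw [hfam, W.formalGroupLaw_subst_zero W.hasSubst_formalNeg]

/-- `∂ᵤ(u -_F v) = F_u(u, i(v))`. [folklore] -/
theorem pderiv_zero_formalGroupLawSub :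
    MvPowerSeries.pderiv 0 W.formalGroupLawSub =
      MvPowerSeries.subst ![MvPowerSeries.X 0,
        W.formalNeg.subst (MvPowerSeries.X 1 : MvPowerSeries (Fin 2) R)]
        (MvPowerSeries.pderiv 0 W.formalGroupLaw) := by
  rw [formalGroupLawSub, MvPowerSeries.pderiv_subst_pair (MvPowerSeries.constantCoeff_X 0)
    (W.constantCoeff_formalNeg_subst_X 1), MvPowerSeries.pderiv_X, if_pos rfl, mul_one,
    MvPowerSeries.pderiv_powerSeries_subst_X, if_neg (by decide), mul_zero, add_zero]

/-- **`F_u(0, i(v)) = η(i(v))`**: `∂ᵤ(u -_F v)(0, v) = η(i(v))`. [Silverman AEC IV.4.2] [folklore] -/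
theorem subst_zero_X_pderiv_formalGroupLawSub :
    MvPowerSeries.subst ![(0 : R⟦X⟧), PowerSeries.X] (MvPowerSeries.pderiv 0 W.formalGroupLawSub) =
      W.formalEta.subst W.formalNeg := by
  have hs := hasSubst_zero_X (R := R)
  rw [W.pderiv_zero_formalGroupLawSub,
    MvPowerSeries.subst_comp_subst_apply W.hasSubst_pair_formalNeg hs]
  have hfam : (fun s => MvPowerSeries.subst ![(0 : R⟦X⟧), PowerSeries.X]
      ((![MvPowerSeries.X 0, W.formalNeg.subst (MvPowerSeries.X 1 : MvPowerSeries (Fin 2) R)]) s)) =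
      ![(0 : R⟦X⟧), W.formalNeg] := by
    funext s
    fin_cases s
    · exact subst_zero_X_X_zero
    · exact subst_zero_X_powerSeries_subst_X_one W.formalNeg
  rw [hfam, subst_zero_pair_eq W.hasSubst_formalNeg, W.subst_zero_X_pderiv_formalGroupLaw]

/-- `σ(u +_F v)(0, v) = σ(v)`. [folklore] -/
theorem subst_zero_X_subst_formalGroupLaw (σ : R⟦X⟧) :
    MvPowerSeries.subst ![(0 : R⟦X⟧), PowerSeries.X] (σ.subst W.formalGroupLaw) = σ := by
  rw [mvSubst_powerSeries_subst W.hasSubst_formalGroupLaw hasSubst_zero_X,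
    W.formalGroupLaw_subst_zero_X, PowerSeries.X_subst]

/-- `σ(u -_F v)(0, v) = σ(i(v))`. [folklore] -/
theorem subst_zero_X_subst_formalGroupLawSub (σ : R⟦X⟧) :
    MvPowerSeries.subst ![(0 : R⟦X⟧), PowerSeries.X] (σ.subst W.formalGroupLawSub) =
      σ.subst W.formalNeg := by
  rw [mvSubst_powerSeries_subst (PowerSeries.HasSubst.of_constantCoeff_zero
    W.constantCoeff_formalGroupLawSub) hasSubst_zero_X, W.subst_zero_X_formalGroupLawSub]

/-- **`∂ᵤσ(u +_F v)(0, v) = (Dσ)(v)`** (`F_u(0, v) = η(v)`). [Silverman AEC IV.4.2;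
Blakestad–Grant 2023, proof of Prop. 14] [folklore] -/
theorem subst_zero_X_pderiv_subst_formalGroupLaw (σ : R⟦X⟧) :
    MvPowerSeries.subst ![(0 : R⟦X⟧), PowerSeries.X]
        (MvPowerSeries.pderiv 0 (σ.subst W.formalGroupLaw)) = W.formalInvariantDerivation σ := by
  have hs := hasSubst_zero_X (R := R)
  rw [MvPowerSeries.pderiv_powerSeries_subst W.constantCoeff_formalGroupLaw, MvPowerSeries.subst_mul hs,
    mvSubst_powerSeries_subst W.hasSubst_formalGroupLaw hs, W.formalGroupLaw_subst_zero_X,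
    PowerSeries.X_subst, W.subst_zero_X_pderiv_formalGroupLaw, formalInvariantDerivation_apply, mul_comm]

/-- **`∂ᵤσ(u -_F v)(0, v) = (Dσ)(i(v))`** (`F_u(0, i(v)) = η(i(v))`). [Silverman AEC IV.4.2;
Blakestad–Grant 2023, proof of Prop. 14] [folklore] -/
theorem subst_zero_X_pderiv_subst_formalGroupLawSub (σ : R⟦X⟧) :
    MvPowerSeries.subst ![(0 : R⟦X⟧), PowerSeries.X]
        (MvPowerSeries.pderiv 0 (σ.subst W.formalGroupLawSub)) =
      (W.formalInvariantDerivation σ).subst W.formalNeg := by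
  have hs := hasSubst_zero_X (R := R)
  have hn := W.hasSubst_formalNeg
  rw [MvPowerSeries.pderiv_powerSeries_subst W.constantCoeff_formalGroupLawSub,
    MvPowerSeries.subst_mul hs, mvSubst_powerSeries_subst
      (PowerSeries.HasSubst.of_constantCoeff_zero W.constantCoeff_formalGroupLawSub) hs,
    W.subst_zero_X_formalGroupLawSub, W.subst_zero_X_pderiv_formalGroupLawSub,
    formalInvariantDerivation_apply, PowerSeries.subst_mul hn, mul_comm]

/-! ### `L̃ = σ(u +_F v)σ(u -_F v)v²` and `R̃ = (u²X(v) - v²X(u))s(u)²σ(v)²` at `u = 0` -/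

section Tilde

variable {W}

/-- **`L̃(0, v) = -σ(v)²v²`** for `σ` odd. [Blakestad–Grant 2023, proof of Prop. 14] [folklore] -/
theorem subst_zero_X_thetaLTilde {σ : R⟦X⟧} (hodd : W.IsFormallyOdd σ) :
    MvPowerSeries.subst ![(0 : R⟦X⟧), PowerSeries.X]
        (σ.subst W.formalGroupLaw * σ.subst W.formalGroupLawSub *
          (MvPowerSeries.X 1 : MvPowerSeries (Fin 2) R) ^ 2) = -(σ ^ 2 * X ^ 2) := by
  have hs := hasSubst_zero_X (R := R)
  rw [MvPowerSeries.subst_mul hs, MvPowerSeries.subst_mul hs, MvPowerSeries.subst_pow hs,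
    W.subst_zero_X_subst_formalGroupLaw, W.subst_zero_X_subst_formalGroupLawSub,
    show σ.subst W.formalNeg = -σ from hodd, subst_zero_X_X_one]
  ring

/-- **`∂ᵤL̃(0, v) = 0`** for `σ` odd: `∂ᵤL̃|₀ = ((Dσ)(v)·σ(i(v)) + σ(v)·(Dσ)(i(v)))v²` and `Dσ` is
even. [Blakestad–Grant 2023, proof of Prop. 14 ("odd in `t₁`")] [folklore] -/
theorem subst_zero_X_pderiv_thetaLTilde {σ : R⟦X⟧} (hodd : W.IsFormallyOdd σ) :
    MvPowerSeries.subst ![(0 : R⟦X⟧), PowerSeries.X]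
        (MvPowerSeries.pderiv 0 (σ.subst W.formalGroupLaw * σ.subst W.formalGroupLawSub *
          (MvPowerSeries.X 1 : MvPowerSeries (Fin 2) R) ^ 2)) = 0 := by
  have hs := hasSubst_zero_X (R := R)
  have hv : MvPowerSeries.pderiv 0 ((MvPowerSeries.X 1 : MvPowerSeries (Fin 2) R) ^ 2) = 0 := by
    rw [Derivation.leibniz_pow, MvPowerSeries.pderiv_X, if_neg (by decide), smul_zero, smul_zero]
  rw [Derivation.leibniz, hv, smul_zero, zero_add, Derivation.leibniz, smul_eq_mul, smul_eq_mul,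
    smul_eq_mul, MvPowerSeries.subst_mul hs, MvPowerSeries.subst_add hs, MvPowerSeries.subst_mul hs,
    MvPowerSeries.subst_mul hs, MvPowerSeries.subst_pow hs, W.subst_zero_X_subst_formalGroupLaw,
    W.subst_zero_X_subst_formalGroupLawSub, W.subst_zero_X_pderiv_subst_formalGroupLaw,
    W.subst_zero_X_pderiv_subst_formalGroupLawSub, W.formalInvariantDerivation_subst_formalNeg_of_odd hodd,
    show σ.subst W.formalNeg = -σ from hodd, subst_zero_X_X_one]
  ring

/-- **`R̃(0, v) = -σ(v)²v²`** (`X(0) = 1`, `s(0) = 1`). [Blakestad–Grant 2023, proof of Prop. 14]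
[folklore] -/
theorem subst_zero_X_thetaRTilde (σ : R⟦X⟧) {s : R⟦X⟧} (hs0 : constantCoeff s = 1) :
    MvPowerSeries.subst ![(0 : R⟦X⟧), PowerSeries.X]
        (((MvPowerSeries.X 0 : MvPowerSeries (Fin 2) R) ^ 2 *
            W.formalXMulSq.subst (MvPowerSeries.X 1 : MvPowerSeries (Fin 2) R) -
          (MvPowerSeries.X 1 : MvPowerSeries (Fin 2) R) ^ 2 *
            W.formalXMulSq.subst (MvPowerSeries.X 0 : MvPowerSeries (Fin 2) R)) *
          s.subst (MvPowerSeries.X 0 : MvPowerSeries (Fin 2) R) ^ 2 *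
          σ.subst (MvPowerSeries.X 1 : MvPowerSeries (Fin 2) R) ^ 2) = -(σ ^ 2 * X ^ 2) := by
  have hs := hasSubst_zero_X (R := R)
  rw [MvPowerSeries.subst_mul hs, MvPowerSeries.subst_mul hs, MvPowerSeries.subst_sub hs,
    MvPowerSeries.subst_mul hs, MvPowerSeries.subst_mul hs, MvPowerSeries.subst_pow hs,
    MvPowerSeries.subst_pow hs, MvPowerSeries.subst_pow hs, MvPowerSeries.subst_pow hs,
    subst_zero_X_X_zero, subst_zero_X_X_one, subst_zero_X_powerSeries_subst_X_one,
    subst_zero_X_powerSeries_subst_X_one, subst_zero_X_powerSeries_subst_X_zero,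
    subst_zero_X_powerSeries_subst_X_zero, W.constantCoeff_formalXMulSq, hs0, map_one]
  ring

/-- **`∂ᵤR̃(0, v) = 0`** when `X = 1 - a₁z + ⋯` and `s = 1 + (a₁/2)z + ⋯`, i.e. `2·coeff₁ s = a₁`
(`∂ᵤR̃|₀ = -v²X'(0)σ² - v²·2s(0)s'(0)·σ² = (a₁ - 2s'(0))v²σ²`). [Blakestad–Grant 2023, proof of
Prop. 14 ("comparing the expansions … in `t₁`")] [folklore] -/
theorem subst_zero_X_pderiv_thetaRTilde (σ : R⟦X⟧) {s : R⟦X⟧} (hs0 : constantCoeff s = 1)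
    (hs1 : 2 * coeff 1 s = W.a₁) :
    MvPowerSeries.subst ![(0 : R⟦X⟧), PowerSeries.X]
        (MvPowerSeries.pderiv 0
          (((MvPowerSeries.X 0 : MvPowerSeries (Fin 2) R) ^ 2 *
              W.formalXMulSq.subst (MvPowerSeries.X 1 : MvPowerSeries (Fin 2) R) -
            (MvPowerSeries.X 1 : MvPowerSeries (Fin 2) R) ^ 2 *
              W.formalXMulSq.subst (MvPowerSeries.X 0 : MvPowerSeries (Fin 2) R)) *
            s.subst (MvPowerSeries.X 0 : MvPowerSeries (Fin 2) R) ^ 2 *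
            σ.subst (MvPowerSeries.X 1 : MvPowerSeries (Fin 2) R) ^ 2)) = 0 := by
  have hs := hasSubst_zero_X (R := R)
  set u := (MvPowerSeries.X 0 : MvPowerSeries (Fin 2) R) with hu
  set v := (MvPowerSeries.X 1 : MvPowerSeries (Fin 2) R) with hv
  have hpu : MvPowerSeries.pderiv 0 u = 1 := by rw [hu, MvPowerSeries.pderiv_X, if_pos rfl]
  have hpv : MvPowerSeries.pderiv 0 v = 0 := by rw [hv, MvPowerSeries.pderiv_X, if_neg (by decide)]
  have hpsu : MvPowerSeries.pderiv 0 (s.subst u) = (d⁄dX R s).subst u := by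
    rw [hu, MvPowerSeries.pderiv_powerSeries_subst_X, if_pos rfl]
  have hpσv : MvPowerSeries.pderiv 0 (σ.subst v) = 0 := by
    rw [hv, MvPowerSeries.pderiv_powerSeries_subst_X, if_neg (by decide)]
  have hpXu : MvPowerSeries.pderiv 0 (W.formalXMulSq.subst u) = (d⁄dX R W.formalXMulSq).subst u := by
    rw [hu, MvPowerSeries.pderiv_powerSeries_subst_X, if_pos rfl]
  have hpXv : MvPowerSeries.pderiv 0 (W.formalXMulSq.subst v) = 0 := by
    rw [hv, MvPowerSeries.pderiv_powerSeries_subst_X, if_neg (by decide)]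
  -- the `u`-derivative, written without numerals
  have hd : MvPowerSeries.pderiv 0 ((u ^ 2 * W.formalXMulSq.subst v - v ^ 2 * W.formalXMulSq.subst u) *
        s.subst u ^ 2 * σ.subst v ^ 2) =
      (((u + u) * W.formalXMulSq.subst v - v ^ 2 * (d⁄dX R W.formalXMulSq).subst u) * s.subst u ^ 2 +
        (u ^ 2 * W.formalXMulSq.subst v - v ^ 2 * W.formalXMulSq.subst u) *
          ((s.subst u + s.subst u) * (d⁄dX R s).subst u)) * σ.subst v ^ 2 := by
    simp only [Derivation.leibniz, Derivation.leibniz_pow, map_sub, smul_eq_mul, nsmul_eq_mul,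
      Nat.cast_ofNat, hpu, hpv, hpsu, hpσv, hpXu, hpXv]
    ring
  have hds : constantCoeff (d⁄dX R s) = coeff 1 s := by
    rw [← coeff_zero_eq_constantCoeff_apply, coeff_derivative]; simp
  have hdX : constantCoeff (d⁄dX R W.formalXMulSq) = -W.a₁ := by
    rw [← coeff_zero_eq_constantCoeff_apply, coeff_derivative, W.coeff_one_formalXMulSq]; simp
  rw [hd]
  simp only [MvPowerSeries.subst_add hs, MvPowerSeries.subst_sub hs, MvPowerSeries.subst_mul hs,
    MvPowerSeries.subst_pow hs, hu, hv, subst_zero_X_X_zero, subst_zero_X_X_one,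
    subst_zero_X_powerSeries_subst_X_one, subst_zero_X_powerSeries_subst_X_zero,
    W.constantCoeff_formalXMulSq, hs0, hds, hdX, map_one, map_neg]
  have h2 : (C (coeff 1 s) : R⟦X⟧) + C (coeff 1 s) = C W.a₁ := by
    rw [← hs1, two_mul, map_add]
  linear_combination (-(σ ^ 2 * X ^ 2)) * h2

end Tilde

end WeierstrassCurve
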